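import Summits.BirchSwinnertonDyer.Rank1Residual.P2.CongruentNumberSilentEvenFiveThetaCMDescent
import Literature.NumberTheory.EllipticCurves.CongruentNumberEvenFiveSelmerBoundThreeModEight
import HarnessLib

/-!
# Cell `bsd-monsky`, route B: the `q ≡ 3 (mod 8)` ROWS of the even-five family from ONE display ALONE —
# `ord_{s=1} L(E_{2pq}, s) = 1 ∧ BSD(E_{2pq}, 2)` for ALL primes `p ≡ 5 (mod 8)`, `q ≡ 3 (mod 8)`, either symbol

HONEST FRAMING (cell `bsd-monsky`, run/shared/lean/pub/bsd-monsky/; README §1): the cell's theorem is Theorem 1.1 on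
`𝒮⁻`; the rows here are PROOF-B §10's complementary record (README §3: «record what the same argument gives, no
more»); nothing is booked by this file. `…GenusParity.lean` proved
`analyticRank_eq_one_and_bsdp_two_three_mod_eight_of_thetaDisplay_of_selmer_le_eight (hΘ) (hSel₃)`: for
`p ≡ 5 (mod 8)`, `q ≡ 3 (mod 8)` — BOTH signs of `(p/q)` — `g(2pq)` is odd unconditionally, so the route-B engine
gives `ord = 1 ∧ BSD₂` per pair from the display and a `2`-Selmer bound `hSel₃ : #Sel₂(E_{2pq}) ≤ 8`. That bound is
now the tree theorem `card_selmerGroup_two_le_eight_congruentNumberCurve_two_mul_five_three_mod_eight`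
(`CongruentNumberEvenFiveSelmerBoundThreeModEight.lean`: complete `2`-descent on Selmer classes from the places
`p`, `q`, `∞` and the good primes — on the half `(p/q) = −1` for every `q ≡ 3 (mod 4)`, on the half `(p/q) = +1`
exactly because `(2/q) = −1` for `q ≡ 3 (mod 8)`; no `2`-adic condition). Hence **for ALL primes `p ≡ 5 (mod 8)`,
`q ≡ 3 (mod 8)`: `ord_{s=1} L(E_{2pq}, s) = 1 ∧ BSD(E_{2pq}, 2)` relative to ONE display alone** — the route-B display
`K_B` (`hΘ`), or the Literature display `tyz_cmPointGaloisData` (`hCM`), or its split form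
`tyz_cmPointClassFieldData` (`hCF`): no TYZ Thm. 1.2, no Gross–Zagier–Kolyvagin binder, no Rédei–Reichardt, no
Monsky 1990, no Heath-Brown 1994, no Aoki 1999. CONDITIONAL on the one display; nothing asserted; no mark moved.
[cite: TianYuanZhang2017, §1 ((1.1)), §3.1, Prop. 3.2, Thm. 3.5, Thm. 3.6, Lemma 3.21]
[cite: Cox2013, Theorem 6.1 (ii) and Theorem 9.18] [cite: SilvermanAEC2009, Prop. X.1.4, Prop. X.4.9, Thm. X.4.2]
[cite: Miller2011LMS, Def. 1.1 (arXiv:1010.2431 p. 3)]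
-/

noncomputable section

open scoped Classical

open WeierstrassCurve NumberField Literature.NumberTheory.EllipticCurves
  Literature.NumberTheory.EllipticCurves.TianYuanZhang2017 Literature.NumberTheory.QuadraticFields

namespace Summit.BirchSwinnertonDyer.Rank1Residual.P2

open ThetaDescent Conjectures

/-- **`#Sel₂(E_{2pq}) ≤ 8` for all `p ≡ 5 (mod 8)`, `q ≡ 3 (mod 8)`** — the binder `hSel₃` of
`…GenusParity.lean`'s `q ≡ 3 (mod 8)` door, PROVED (tree's complete `2`-descent, both signs of `(p/q)`).
Unconditional. [cite: SilvermanAEC2009, Prop. X.1.4, Prop. X.4.9] -/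
theorem selmer_le_eight_three_mod_eight :
    ∀ p q : ℕ, p.Prime → q.Prime → p % 8 = 5 → q % 8 = 3 →
      Nat.card ((congruentNumberCurve (2 * (p * q))).selmerGroup 2) ≤ 8 :=
  fun _ _ hp hq hp5 hq3 => card_selmerGroup_two_le_eight_congruentNumberCurve_two_mul_five_three_mod_eight hp hq hp5 hq3

/-- **The `q ≡ 3 (mod 8)` rows from the route-B display `K_B` ALONE**: for all primes `p ≡ 5 (mod 8)`,
`q ≡ 3 (mod 8)` (either symbol), `ord_{s=1} L(E_{2pq}, s) = 1 ∧ BSD(E_{2pq}, 2)`. CONDITIONAL on `hΘ`; nothing asserted.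
[cite: TianYuanZhang2017, §1 ((1.1)), Thm. 3.5] [cite: SilvermanAEC2009, Prop. X.1.4, Prop. X.4.9, Thm. X.4.2]
[cite: Miller2011LMS, Def. 1.1 (arXiv:1010.2431 p. 3)] -/
theorem analyticRank_eq_one_and_bsdp_two_three_mod_eight_of_thetaDisplay_descent
    (hΘ : ∀ p q : ℕ, p.Prime → q.Prime → p % 8 = 5 → q % 4 = 3 → thetaGenusPointDatum p q)
    {p q : ℕ} (hp : p.Prime) (hq : q.Prime) (hp5 : p % 8 = 5) (hq3 : q % 8 = 3) :
    (congruentNumberCurve (2 * (p * q))).analyticRank = 1 ∧ BSDp (congruentNumberCurve (2 * (p * q))) 2 :=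
  analyticRank_eq_one_and_bsdp_two_three_mod_eight_of_thetaDisplay_of_selmer_le_eight hΘ
    selmer_le_eight_three_mod_eight hp hq hp5 hq3

/-- **The `q ≡ 3 (mod 8)` rows from the Literature display `tyz_cmPointGaloisData` ALONE.** CONDITIONAL; nothing asserted.
[cite: TianYuanZhang2017, §1 ((1.1)), §3.1, Thm. 3.5, Thm. 3.6, Lemma 3.21] [cite: SilvermanAEC2009, Prop. X.1.4, Prop. X.4.9, Thm. X.4.2]
[cite: Miller2011LMS, Def. 1.1 (arXiv:1010.2431 p. 3)] -/
theorem analyticRank_eq_one_and_bsdp_two_three_mod_eight_of_cmPointGaloisData_descent (hCM : tyz_cmPointGaloisData)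
    {p q : ℕ} (hp : p.Prime) (hq : q.Prime) (hp5 : p % 8 = 5) (hq3 : q % 8 = 3) :
    (congruentNumberCurve (2 * (p * q))).analyticRank = 1 ∧ BSDp (congruentNumberCurve (2 * (p * q))) 2 :=
  analyticRank_eq_one_and_bsdp_two_three_mod_eight_of_thetaDisplay_descent (thetaDisplay_of_cmPointGaloisData hCM)
    hp hq hp5 hq3

/-- **The `q ≡ 3 (mod 8)` rows from the split Literature display `tyz_cmPointClassFieldData` ALONE** (every conjunct a
printed sentence: TYZ §3 + Cox Thm. 6.1 (ii) / Thm. 9.18). CONDITIONAL; nothing asserted.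
[cite: TianYuanZhang2017, §1 ((1.1)), §3.1, Prop. 3.2, Thm. 3.5, Thm. 3.6, Lemma 3.21] [cite: Cox2013, Theorem 6.1 (ii) and Theorem 9.18]
[cite: SilvermanAEC2009, Prop. X.1.4, Prop. X.4.9, Thm. X.4.2] [cite: Miller2011LMS, Def. 1.1 (arXiv:1010.2431 p. 3)] -/
theorem analyticRank_eq_one_and_bsdp_two_three_mod_eight_of_cmPointClassFieldData_descent
    (hCF : tyz_cmPointClassFieldData) {p q : ℕ} (hp : p.Prime) (hq : q.Prime) (hp5 : p % 8 = 5) (hq3 : q % 8 = 3) :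
    (congruentNumberCurve (2 * (p * q))).analyticRank = 1 ∧ BSDp (congruentNumberCurve (2 * (p * q))) 2 :=
  analyticRank_eq_one_and_bsdp_two_three_mod_eight_of_thetaDisplay_descent (thetaDisplay_of_cmPointClassFieldData hCF)
    hp hq hp5 hq3

end Summit.BirchSwinnertonDyer.Rank1Residual.P2

end
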